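import Literature.NumberTheory.EllipticCurves.KubertTateNineInvariants
import HarnessLib

/-!
# Kubert's `ℤ/9` family `E₉(f)`, `f ∈ ℚ`: the `3`-adic valuations of `c₄, c₆, Δ` on and off the additive
# fibre `3 ∣ num(f) + den(f)`

Topic `NumberTheory/EllipticCurves`; continues `KubertTateNineInvariants` (the invariants of
`E₉(f) = E(f²(f-1)(f²-f+1), f²(f-1))` as polynomials, their homogeneous forms in `(num f, den f)` and the
`3`-adic arithmetic of those forms). THEOREMS ONLY (no definition, no named fact, no `sorry`). Used by
`KubertTateNineLocalDataThree` (Kodaira type `IV`, `f₃ = 3` on the additive fibre; `I₉ₑ` elsewhere).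

## What is here (`f ∈ ℚ`, `E₉(f)` the rational Tate normal form)

* ON THE ADDITIVE FIBRE `3 ∣ num(f) + den(f)` (Barrios–Roy: `v₃(a + b) ≥ 1`):
  **`(v₃ c₄, v₃ c₆, v₃ Δ)(E₉ f) = (2, 3, 5)`** (`padicValRat_kubertTate_nine_c₄_of_three_dvd`, `…c₆…`,
  `…Δ…`; in print: Barrios–Roy §3.5 Case 3, "`v₃(Δ) = 5`" on their `3`-integral model).
* OFF IT (`3 ∤ num + den`): `v₃ c₄ = -12·v₃(den)`, `v₃ c₆ = -18·v₃(den)`,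
  `v₃ Δ = 9·(v₃ num + v₃(num - den)) - 27·v₃(den)` (`…_of_not_three_dvd`).
* `c₄(E₉ f) ≠ 0` and `c₆(E₉ f) ≠ 0` for EVERY `f ∈ ℚ` (`kubertTate_nine_c₄_ne_zero`, `kubertTate_nine_c₆_ne_zero`),
  and `Δ(E₉ f) ≠ 0 ⟹ f ∉ {0, 1}`.

References: [BarriosRoy2022LocalData] A. J. Barrios, M. Roy, Pacific J. Math. 318 (2022), Thm. 3.8 (table,
row `C₉`) and §3.5 Case 3 (arXiv:2104.10337 pp. 18–20); [Kubert1976] Table 3 (`N = 9`).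
-/

noncomputable section

open scoped Classical

namespace WeierstrassCurve

/-- `v₃(zⁿ) = n·v₃(z)`. [folklore] -/
private theorem padicValInt_pow' (z : ℤ) (n : ℕ) : padicValInt 3 (z ^ n) = n * padicValInt 3 z := by
  haveI : Fact (Nat.Prime 3) := ⟨Nat.prime_three⟩
  simp [padicValInt, Int.natAbs_pow, padicValNat.pow]

/-! ### §4 The `3`-adic valuations of `c₄, c₆, Δ` of `E₉(f)`, `f ∈ ℚ` -/

section Valuations

variable (f : ℚ)

/-- `v₃((Z : ℚ)/dᵏ) = v₃(Z) - k·v₃(d)`. [folklore] -/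
private theorem padicValRat_intCast_div_natCast_pow {Z : ℤ} (hZ : Z ≠ 0) {d : ℕ} (hd : d ≠ 0) (k : ℕ) :
    padicValRat 3 ((Z : ℚ) / (d : ℚ) ^ k) = (padicValInt 3 Z : ℤ) - k * (padicValNat 3 d : ℤ) := by
  haveI : Fact (Nat.Prime 3) := ⟨Nat.prime_three⟩
  rw [padicValRat.div (by exact_mod_cast hZ) (pow_ne_zero _ (by exact_mod_cast hd)), padicValRat.pow,
    padicValRat.of_int, padicValRat.of_nat]

/-- `v₃(X) ≠ 0 ⟹ X ≠ 0`. [folklore] -/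
private theorem ne_zero_of_padicValInt_ne_zero {X : ℤ} (h : padicValInt 3 X ≠ 0) : X ≠ 0 := by
  rintro rfl
  exact h padicValInt.zero

/-- `3 ∤ X ⟹ X ≠ 0`. [folklore] -/
private theorem ne_zero_of_not_three_dvd {X : ℤ} (h : ¬ (3 : ℤ) ∣ X) : X ≠ 0 := by
  rintro rfl
  exact h (dvd_zero 3)

/-- `3 ∤ den(f)` in `ℕ` from `3 ∤ den(f)` in `ℤ`. [folklore] -/
private theorem not_three_dvd_den_nat {f : ℚ} (h : ¬ (3 : ℤ) ∣ (f.den : ℤ)) : ¬ 3 ∣ f.den :=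
  fun h' => h (by exact_mod_cast h')

/-- `num(f)` and `den(f)` are coprime: `3 ∣ num + den ⟹ 3 ∤ den`. [folklore] -/
private theorem not_three_dvd_den_of_three_dvd_num_add_den (h : (3 : ℤ) ∣ f.num + f.den) :
    ¬ (3 : ℤ) ∣ (f.den : ℤ) := by
  intro hd
  have hn : (3 : ℤ) ∣ f.num := by
    have := dvd_sub h hd
    simpa using this
  have hcop : IsCoprime f.num (f.den : ℤ) := by
    rw [Int.isCoprime_iff_gcd_eq_one]
    exact f.reduced
  have hu := hcop.isUnit_of_dvd' hn hd
  rw [Int.isUnit_iff] at hu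
  omega

/-- On the fibre `3 ∣ m + n`, `3 ∤ n`: `3 ∤ m` and `3 ∤ m - n`. [folklore] -/
private theorem not_three_dvd_and_not_three_dvd_sub_of_three_dvd_add {m n : ℤ} (h3 : (3 : ℤ) ∣ m + n)
    (hn : ¬ (3 : ℤ) ∣ n) : ¬ (3 : ℤ) ∣ m ∧ ¬ (3 : ℤ) ∣ m - n := by
  obtain ⟨k, hk⟩ := h3
  constructor <;> intro h <;> apply hn <;> omega

/-! #### The additive fibre `3 ∣ num(f) + den(f)` (i.e. `f ≡ -1 (mod 3ℤ₍₃₎)`) -/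

/-- **`v₃(c₄(E₉(f))) = 2` on the fibre `3 ∣ num(f) + den(f)`.**
[cite: BarriosRoy2022LocalData, Thm. 3.8 (table, T = C₉, p = 3)] -/
theorem padicValRat_kubertTate_nine_c₄_of_three_dvd (h : (3 : ℤ) ∣ f.num + f.den) :
    padicValRat 3 (kubertTate (f ^ 2 * (f - 1) * (f ^ 2 - f + 1)) (f ^ 2 * (f - 1))).c₄ = 2 := by
  haveI : Fact (Nat.Prime 3) := ⟨Nat.prime_three⟩
  have hn := not_three_dvd_den_of_three_dvd_num_add_den f h
  have hA := padicValInt_kubertNineA₃_of_three_dvd h hn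
  have hP := padicValInt_kubertNineP₉_of_three_dvd h hn
  have hA0 := ne_zero_of_padicValInt_ne_zero (X := _) (by rw [hA]; decide)
  have hP0 := ne_zero_of_padicValInt_ne_zero (X := _) (by rw [hP]; decide)
  rw [kubertTate_nine_c₄_eq_num_den, padicValRat_intCast_div_natCast_pow (mul_ne_zero hA0 hP0)
    f.den_ne_zero, padicValInt.mul hA0 hP0, hA, hP,
    padicValNat.eq_zero_of_not_dvd (not_three_dvd_den_nat hn)]
  norm_num

/-- **`v₃(c₆(E₉(f))) = 3` on the fibre `3 ∣ num(f) + den(f)`.**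
[cite: BarriosRoy2022LocalData, Thm. 3.8 (table, T = C₉, p = 3)] -/
theorem padicValRat_kubertTate_nine_c₆_of_three_dvd (h : (3 : ℤ) ∣ f.num + f.den) :
    padicValRat 3 (kubertTate (f ^ 2 * (f - 1) * (f ^ 2 - f + 1)) (f ^ 2 * (f - 1))).c₆ = 3 := by
  haveI : Fact (Nat.Prime 3) := ⟨Nat.prime_three⟩
  have hn := not_three_dvd_den_of_three_dvd_num_add_den f h
  have hC := padicValInt_kubertNineC₆_of_three_dvd h hn
  have hC0 := ne_zero_of_padicValInt_ne_zero (X := _) (by rw [hC]; decide)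
  rw [kubertTate_nine_c₆_eq_num_den, padicValRat_intCast_div_natCast_pow hC0 f.den_ne_zero, hC,
    padicValNat.eq_zero_of_not_dvd (not_three_dvd_den_nat hn)]
  norm_num

/-- **`v₃(Δ(E₉(f))) = 5` on the fibre `3 ∣ num(f) + den(f)`** (`0 + 0 + 3·1 + 2` along
`Δ = num⁹ (num - den)⁹ Q³ L / den²⁷`). [cite: BarriosRoy2022LocalData, Thm. 3.8 (table, T = C₉, p = 3)] -/
theorem padicValRat_kubertTate_nine_Δ_of_three_dvd (h : (3 : ℤ) ∣ f.num + f.den) :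
    padicValRat 3 (kubertTate (f ^ 2 * (f - 1) * (f ^ 2 - f + 1)) (f ^ 2 * (f - 1))).Δ = 5 := by
  haveI : Fact (Nat.Prime 3) := ⟨Nat.prime_three⟩
  have hn := not_three_dvd_den_of_three_dvd_num_add_den f h
  obtain ⟨hm, hmn⟩ := not_three_dvd_and_not_three_dvd_sub_of_three_dvd_add h hn
  have hQ := padicValInt_kubertNineQ_of_three_dvd h hn
  have hL := padicValInt_kubertNineL_of_three_dvd h hn
  have hm0 := ne_zero_of_not_three_dvd hm
  have hmn0 := ne_zero_of_not_three_dvd hmn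
  have hQ0 := ne_zero_of_padicValInt_ne_zero (X := _) (by rw [hQ]; decide)
  have hL0 := ne_zero_of_padicValInt_ne_zero (X := _) (by rw [hL]; decide)
  rw [kubertTate_nine_Δ_eq_num_den, padicValRat_intCast_div_natCast_pow
    (mul_ne_zero (mul_ne_zero (mul_ne_zero (pow_ne_zero _ hm0) (pow_ne_zero _ hmn0))
      (pow_ne_zero _ hQ0)) hL0) f.den_ne_zero,
    padicValInt.mul (mul_ne_zero (mul_ne_zero (pow_ne_zero _ hm0) (pow_ne_zero _ hmn0))
      (pow_ne_zero _ hQ0)) hL0,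
    padicValInt.mul (mul_ne_zero (pow_ne_zero _ hm0) (pow_ne_zero _ hmn0)) (pow_ne_zero _ hQ0),
    padicValInt.mul (pow_ne_zero _ hm0) (pow_ne_zero _ hmn0),
    padicValInt_pow', padicValInt_pow', padicValInt_pow', padicValInt.eq_zero_of_not_dvd hm,
    padicValInt.eq_zero_of_not_dvd hmn, hQ, hL, padicValNat.eq_zero_of_not_dvd (not_three_dvd_den_nat hn)]
  norm_num

/-! #### Off the additive fibre: `3 ∤ num(f) + den(f)` -/

/-- **`v₃(c₄(E₉(f))) = -12·v₃(den f)` off the fibre** (`3 ∤ num + den`; the numerator form is a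
`3`-adic unit). [cite: BarriosRoy2022LocalData, Thm. 3.8 (table, T = C₉, p = 3)] -/
theorem padicValRat_kubertTate_nine_c₄_of_not_three_dvd (h : ¬ (3 : ℤ) ∣ f.num + f.den) :
    padicValRat 3 (kubertTate (f ^ 2 * (f - 1) * (f ^ 2 - f + 1)) (f ^ 2 * (f - 1))).c₄ =
      -12 * (padicValNat 3 f.den : ℤ) := by
  haveI : Fact (Nat.Prime 3) := ⟨Nat.prime_three⟩
  have hA := not_three_dvd_kubertNineA₃ h
  have hP := not_three_dvd_kubertNineP₉ h
  rw [kubertTate_nine_c₄_eq_num_den, padicValRat_intCast_div_natCast_pow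
    (mul_ne_zero (ne_zero_of_not_three_dvd hA) (ne_zero_of_not_three_dvd hP)) f.den_ne_zero,
    padicValInt.mul (ne_zero_of_not_three_dvd hA) (ne_zero_of_not_three_dvd hP),
    padicValInt.eq_zero_of_not_dvd hA, padicValInt.eq_zero_of_not_dvd hP]
  push_cast
  ring

/-- **`v₃(c₆(E₉(f))) = -18·v₃(den f)` off the fibre.** [cite: BarriosRoy2022LocalData, Thm. 3.8 (table, T = C₉, p = 3)] -/
theorem padicValRat_kubertTate_nine_c₆_of_not_three_dvd (h : ¬ (3 : ℤ) ∣ f.num + f.den) :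
    padicValRat 3 (kubertTate (f ^ 2 * (f - 1) * (f ^ 2 - f + 1)) (f ^ 2 * (f - 1))).c₆ =
      -18 * (padicValNat 3 f.den : ℤ) := by
  haveI : Fact (Nat.Prime 3) := ⟨Nat.prime_three⟩
  have hC := not_three_dvd_kubertNineC₆ h
  rw [kubertTate_nine_c₆_eq_num_den, padicValRat_intCast_div_natCast_pow (ne_zero_of_not_three_dvd hC)
    f.den_ne_zero, padicValInt.eq_zero_of_not_dvd hC]
  push_cast
  ring

/-- **`v₃(Δ(E₉(f))) = 9·(v₃(num f) + v₃(num f - den f)) - 27·v₃(den f)` off the fibre** (`f ∉ {0, 1}`;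
the factors `Q`, `L` are `3`-adic units). [cite: BarriosRoy2022LocalData, Thm. 3.8 (table, T = C₉, p = 3)] -/
theorem padicValRat_kubertTate_nine_Δ_of_not_three_dvd (h : ¬ (3 : ℤ) ∣ f.num + f.den) (hf0 : f ≠ 0)
    (hf1 : f ≠ 1) :
    padicValRat 3 (kubertTate (f ^ 2 * (f - 1) * (f ^ 2 - f + 1)) (f ^ 2 * (f - 1))).Δ =
      9 * ((padicValInt 3 f.num : ℤ) + (padicValInt 3 (f.num - f.den) : ℤ))
        - 27 * (padicValNat 3 f.den : ℤ) := by
  haveI : Fact (Nat.Prime 3) := ⟨Nat.prime_three⟩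
  have hQ := not_three_dvd_kubertNineQ h
  have hL := not_three_dvd_kubertNineL h
  have hm0 : f.num ≠ 0 := Rat.num_ne_zero.mpr hf0
  have hmn0 : f.num - f.den ≠ 0 := by
    intro h0
    apply hf1
    have h1 : f.num = f.den := by omega
    rw [← Rat.num_div_den f, h1]
    exact div_self (by exact_mod_cast f.den_ne_zero)
  have hQ0 := ne_zero_of_not_three_dvd hQ
  have hL0 := ne_zero_of_not_three_dvd hL
  rw [kubertTate_nine_Δ_eq_num_den, padicValRat_intCast_div_natCast_pow
    (mul_ne_zero (mul_ne_zero (mul_ne_zero (pow_ne_zero _ hm0) (pow_ne_zero _ hmn0))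
      (pow_ne_zero _ hQ0)) hL0) f.den_ne_zero,
    padicValInt.mul (mul_ne_zero (mul_ne_zero (pow_ne_zero _ hm0) (pow_ne_zero _ hmn0))
      (pow_ne_zero _ hQ0)) hL0,
    padicValInt.mul (mul_ne_zero (pow_ne_zero _ hm0) (pow_ne_zero _ hmn0)) (pow_ne_zero _ hQ0),
    padicValInt.mul (pow_ne_zero _ hm0) (pow_ne_zero _ hmn0),
    padicValInt_pow', padicValInt_pow', padicValInt_pow', padicValInt.eq_zero_of_not_dvd hQ,
    padicValInt.eq_zero_of_not_dvd hL]
  push_cast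
  ring

/-! #### Non-vanishing -/

/-- `c₄(E₉(f)) ≠ 0` for every `f ∈ ℚ` (its `3`-adic valuation is `2` on the additive fibre, and its
numerator form is a `3`-adic unit off it). [cite: BarriosRoy2022LocalData, Thm. 3.8 (table, T = C₉, p = 3)] -/
theorem kubertTate_nine_c₄_ne_zero :
    (kubertTate (f ^ 2 * (f - 1) * (f ^ 2 - f + 1)) (f ^ 2 * (f - 1))).c₄ ≠ 0 := by
  by_cases h : (3 : ℤ) ∣ f.num + f.den
  · intro h0
    have hv := padicValRat_kubertTate_nine_c₄_of_three_dvd f h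
    rw [h0, padicValRat.zero] at hv
    exact absurd hv (by norm_num)
  · rw [kubertTate_nine_c₄_eq_num_den]
    refine div_ne_zero ?_ (pow_ne_zero _ (by exact_mod_cast f.den_ne_zero))
    exact_mod_cast mul_ne_zero (ne_zero_of_not_three_dvd (not_three_dvd_kubertNineA₃ h))
      (ne_zero_of_not_three_dvd (not_three_dvd_kubertNineP₉ h))

/-- `c₆(E₉(f)) ≠ 0` for every `f ∈ ℚ`. [cite: BarriosRoy2022LocalData, Thm. 3.8 (table, T = C₉, p = 3)] -/
theorem kubertTate_nine_c₆_ne_zero :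
    (kubertTate (f ^ 2 * (f - 1) * (f ^ 2 - f + 1)) (f ^ 2 * (f - 1))).c₆ ≠ 0 := by
  by_cases h : (3 : ℤ) ∣ f.num + f.den
  · intro h0
    have hv := padicValRat_kubertTate_nine_c₆_of_three_dvd f h
    rw [h0, padicValRat.zero] at hv
    exact absurd hv (by norm_num)
  · rw [kubertTate_nine_c₆_eq_num_den]
    refine div_ne_zero ?_ (pow_ne_zero _ (by exact_mod_cast f.den_ne_zero))
    exact_mod_cast ne_zero_of_not_three_dvd (not_three_dvd_kubertNineC₆ h)

/-- `Δ(E₉(f)) ≠ 0 ⟹ f ∉ {0, 1}`. [cite: Kubert1976, Table 3 (N = 9)] -/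
theorem kubertTate_nine_ne_zero_and_ne_one_of_Δ_ne_zero
    (hΔ : (kubertTate (f ^ 2 * (f - 1) * (f ^ 2 - f + 1)) (f ^ 2 * (f - 1))).Δ ≠ 0) :
    f ≠ 0 ∧ f ≠ 1 := by
  rw [kubertTate_nine_Δ] at hΔ
  constructor <;> rintro rfl <;> apply hΔ <;> norm_num

end Valuations

end WeierstrassCurve

end
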